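import Summits.Schanuel.Schanuel.Theorems.ZilberEacComplexPerturbedBM
import Summits.Schanuel.Schanuel.Theorems.ZilberEacComplexPunctureDecouplingLemmas
import Literature.ModelTheory.ExponentialFields.Languages
import HarnessLib

/-!
# EC over negative graph bases of any codimension with Brownawell–Masser corner fibre

Zilber's Exponential-Algebraic Closedness for `ℂ_exp` in the open range `dim π₁(V) < n`
(Mantova–Masser, PLMS 129 (2024), §1 p. 5; Aslanyan–Gallinaro arXiv:2409.12860 §3.4;
Dill–Gallinaro arXiv:2506.07550 §1.2), for the class of `n`-folds (`n = t + s`)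
`V = {x'' = G(x'), (x', (yⱼ - Σₖ uₖ Fⱼₖ(u, x'))ⱼ) ∈ W} ⊆ ℂⁿ × (ℂˣ)ⁿ`, where the additive
projection is the graph of a polynomial map `G : ℂˢ → ℂᵗ` (so `dim π₁ V = s`, any
`1 ≤ s ≤ n - 1`) admitting a common lattice direction `q₀` with `Re (Gₖ)_top(2πi q₀) < 0`, the fibre
over the corner `u = y'' = 0` is a Brownawell–Masser variety `W ⊆ ℂˢ × ℂˢ` (irreducible,
`dim W = s`, dominant additive projection), and the gluing `Fⱼₖ ∈ ℂ[u, x']` is arbitrary: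

* `exists_good_direction_forall` — generic lattice directions keeping finitely many signs;
* `exists_expPoint_cornerBM_avoiding`, `exists_expPoint_cornerBM` — `∃ x, (x, (e^{xⱼ} - Σₖ e^{Gₖ(x)} Fⱼₖ(e^{G(x)}, x))ⱼ) ∈ W`,
  with `x` avoiding any given hypersurface (solutions Zariski dense in the base `ℂˢ`);
* `cornerBM_inter_expGraph_nonempty` — `V ∩ Γ_exp ≠ ∅`.

Engine: the localized perturbed Brownawell–Masser theorem
`exists_localized_perturbed_of_dominant` (`ZilberEacComplexPerturbedBM.lean`). The hypersurface
case `t = 1` is `ZilberEacComplexPunctureBM.lean`. HONEST FRAMING: a modest new sub-rung of EAC;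
no bearing on Schanuel's conjecture.
-/

noncomputable section

open Complex MvPolynomial Metric Set Filter Topology
open Literature.NumberTheory.Transcendental

set_option linter.dupNamespace false

namespace Summit.Schanuel.Schanuel.Theorems

/-! ### Corner punctures: bases of any codimension -/

/-- `z ↦ (u(z), z)` is differentiable when the `uₖ` are. [folklore] -/
theorem differentiable_finAppend {s t : ℕ} {u : (Fin s → ℂ) → Fin t → ℂ}
    (hu : ∀ k, Differentiable ℂ fun z => u z k) :
    Differentiable ℂ fun z : Fin s → ℂ => (Fin.append (u z) z : Fin (t + s) → ℂ) := by
  refine differentiable_pi.2 fun i => ?_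
  induction i using Fin.addCases with
  | left k => simp only [Fin.append_left]; exact hu k
  | right j => simp only [Fin.append_right]; exact differentiable_apply j

/-- Sup-norm of `(u, x)` when `‖uₖ‖ ≤ 1` and `‖x‖ ≤ R`, `R ≥ 0`: at most `1 + R`. [folklore] -/
theorem norm_finAppend_le {s t : ℕ} {u : Fin t → ℂ} {x : Fin s → ℂ} {R : ℝ} (hu : ∀ k, ‖u k‖ ≤ 1)
    (hR : 0 ≤ R) (hx : ‖x‖ ≤ R) : ‖(Fin.append u x : Fin (t + s) → ℂ)‖ ≤ 1 + R := by
  rw [pi_norm_le_iff_of_nonneg (by positivity)]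
  intro i
  induction i using Fin.addCases with
  | left k => rw [Fin.append_left]; linarith [hu k]
  | right j => rw [Fin.append_right]; exact (norm_le_pi_norm x j).trans (by linarith)

/-- **A lattice direction avoiding a hypersurface and keeping finitely many signs** (as
`exists_good_direction`, for several forms at once). [folklore] -/
theorem exists_good_direction_forall {s t : ℕ} (Q : MvPolynomial (Fin s) ℂ) (hQ : Q ≠ 0)
    (h : Fin t → MvPolynomial (Fin s) ℂ) (D : Fin t → ℕ) (hh : ∀ k, (h k).IsHomogeneous (D k))
    (q₀ : Fin s → ℤ) (hq₀ : ∀ k, (eval (fun j => 2 * Real.pi * I * (q₀ j : ℂ)) (h k)).re < 0) :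
    ∃ q : Fin s → ℤ, eval (fun j => 2 * Real.pi * I * (q j : ℂ)) Q ≠ 0 ∧
      ∀ k, (eval (fun j => 2 * Real.pi * I * (q j : ℂ)) (h k)).re < 0 := by
  classical
  obtain ⟨q₁, hq₁⟩ := Literature.NumberTheory.Transcendental.ExpDominant.exists_int_eval_ne_zero Q hQ
  set v₀ : Fin s → ℂ := fun j => 2 * Real.pi * I * (q₀ j : ℂ) with hv₀
  set v₁ : Fin s → ℂ := fun j => 2 * Real.pi * I * (q₁ j : ℂ) with hv₁
  have hline : ∀ m : ℕ, (fun j => 2 * Real.pi * I * ((q₁ j + (m : ℤ) * q₀ j : ℤ) : ℂ)) =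
      v₁ + (m : ℂ) • v₀ := by
    intro m; funext j
    simp only [hv₀, hv₁, Pi.add_apply, Pi.smul_apply, smul_eq_mul]
    push_cast
    ring
  set Ψ : Polynomial ℂ :=
    MvPolynomial.aeval (fun i => Polynomial.C (v₁ i) + Polynomial.X * Polynomial.C (v₀ i)) Q with hΨ
  have hΨeval : ∀ z : ℂ, Ψ.eval z = eval (v₁ + z • v₀) Q := by
    intro z
    rw [hΨ, ← Polynomial.coe_aeval_eq_eval, ← AlgHom.comp_apply, MvPolynomial.comp_aeval,
      MvPolynomial.aeval_eq_eval]
    have hF : (fun i => (Polynomial.aeval z) (Polynomial.C (v₁ i) + Polynomial.X * Polynomial.C (v₀ i))) =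
        v₁ + z • v₀ := by
      funext i
      simp only [map_add, map_mul, Polynomial.aeval_C, Polynomial.aeval_X, Algebra.algebraMap_self,
        RingHom.id_apply, Pi.add_apply, Pi.smul_apply, smul_eq_mul, mul_comm z]
    rw [hF]
  have hΨ0 : Ψ ≠ 0 := by
    intro h0
    have := hΨeval 0
    rw [h0, Polynomial.eval_zero, zero_smul, add_zero] at this
    exact hq₁ this.symm
  have hevA : ∀ᶠ m : ℕ in atTop, eval (v₁ + (m : ℂ) • v₀) Q ≠ 0 := by
    have hfin : {m : ℕ | Ψ.IsRoot (m : ℂ)}.Finite :=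
      (Polynomial.finite_setOf_isRoot hΨ0).preimage (Nat.cast_injective.injOn)
    obtain ⟨m₀, hm₀⟩ := hfin.bddAbove
    filter_upwards [eventually_gt_atTop m₀] with m hm
    intro hzero
    have hroot : m ∈ {m : ℕ | Ψ.IsRoot (m : ℂ)} := by
      show Ψ.IsRoot (m : ℂ)
      rw [Polynomial.IsRoot, hΨeval, hzero]
    exact absurd (hm₀ hroot) (not_le.mpr hm)
  have htend : Tendsto (fun m : ℕ => v₀ + (m : ℂ)⁻¹ • v₁) atTop (𝓝 v₀) := by
    have h1 : Tendsto (fun m : ℕ => ((m : ℝ)⁻¹ : ℝ)) atTop (𝓝 0) :=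
      tendsto_inv_atTop_zero.comp tendsto_natCast_atTop_atTop
    have h2 : Tendsto (fun m : ℕ => ((m : ℂ)⁻¹ : ℂ)) atTop (𝓝 0) := by
      have := (Complex.continuous_ofReal.tendsto 0).comp h1
      simp only [Function.comp_def, Complex.ofReal_inv, Complex.ofReal_natCast,
        Complex.ofReal_zero] at this
      exact this
    have h3 : Tendsto (fun m : ℕ => (m : ℂ)⁻¹ • v₁) atTop (𝓝 0) := by
      simpa using h2.smul_const v₁
    simpa using h3.const_add v₀
  have hevB : ∀ k, ∀ᶠ m : ℕ in atTop, (eval (v₁ + (m : ℂ) • v₀) (h k)).re < 0 := by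
    intro k
    have hcont : ContinuousAt (fun w : Fin s → ℂ => (eval w (h k)).re) v₀ :=
      Complex.continuous_re.continuousAt.comp (MvPolynomial.continuous_eval (h k)).continuousAt
    have hnhds : ∀ᶠ w in 𝓝 v₀, (eval w (h k)).re < 0 := hcont.eventually (eventually_lt_nhds (hq₀ k))
    have hev1 : ∀ᶠ m : ℕ in atTop, (eval (v₀ + (m : ℂ)⁻¹ • v₁) (h k)).re < 0 :=
      htend.eventually hnhds
    filter_upwards [hev1, eventually_ge_atTop 1] with m hm hm1
    have hm0 : (m : ℂ) ≠ 0 := by exact_mod_cast (Nat.one_le_iff_ne_zero.mp hm1)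
    have hscale : v₁ + (m : ℂ) • v₀ = (m : ℂ) • (v₀ + (m : ℂ)⁻¹ • v₁) := by
      rw [smul_add, smul_smul, mul_inv_cancel₀ hm0, one_smul, add_comm]
    rw [hscale, (hh k).eval_smul_eq, show ((m : ℂ) ^ D k) = ((m : ℝ) ^ D k : ℝ) by push_cast; rfl,
      Complex.re_ofReal_mul]
    exact mul_neg_of_pos_of_neg (by positivity) hm
  obtain ⟨m, hmA, hmB⟩ := (hevA.and (eventually_all.2 hevB)).exists
  exact ⟨fun j => q₁ j + (m : ℤ) * q₀ j, by rw [hline]; exact hmA, fun k => by rw [hline]; exact hmB k⟩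

/-- **EC over a negative graph base of any codimension with Brownawell–Masser corner fibre,
with exponential points Zariski dense over the base.** Let `s, t ≥ 0`, `n = t + s`, `Gₖ ∈ ℂ[x₁..xₛ]` (`k < t`) of total degrees `Dₖ ≥ 1` admitting a
COMMON lattice direction `q₀` with `Re (Gₖ)_{Dₖ}(2πi q₀) < 0` for all `k`, `W ⊆ ℂˢ × ℂˢ` a
Brownawell–Masser variety (irreducible, `dim W = s`, dominant additive projection) and
`Fⱼₖ ∈ ℂ[u₁..uₜ, x₁..xₛ]` arbitrary. Then there is `x ∈ ℂˢ` with
`(x, (e^{xⱼ} - Σₖ e^{Gₖ(x)} Fⱼₖ(e^{G(x)}, x))ⱼ) ∈ W` avoiding any given hypersurface `h(x) = 0`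
(`h ≠ 0`), i.e. the solutions are Zariski dense in `ℂˢ`; equivalently the `n`-fold
`V = {x'' = G(x'), (x', (yⱼ - Σₖ uₖ Fⱼₖ(u, x'))ⱼ) ∈ W}` (`u = y''`), whose additive projection is
the graph of `G` (dimension `s = dim π₁ V`, any `1 ≤ s ≤ n - 1`), meets the graph of `exp`
(`cornerBM_inter_expGraph_nonempty`). The puncture followed is the corner `u → 0` of
`ℂⁿ × (ℂˣ)ˢ × ℂᵗ`. [cite: MantovaMasser2023, §1 p.5 (the open range dim π(V) < n)] -/
theorem exists_expPoint_cornerBM_avoiding {s t : ℕ} (G : Fin t → MvPolynomial (Fin s) ℂ)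
    (hD : ∀ k, 0 < (G k).totalDegree) (q₀ : Fin s → ℤ)
    (hq₀ : ∀ k, (eval (fun j => 2 * Real.pi * I * (q₀ j : ℂ))
      (homogeneousComponent (G k).totalDegree (G k))).re < 0)
    (W : Set (Fin s ⊕ Fin s → ℂ)) (hW : IsIrreducibleClosed ℂ W) (hdim : zariskiDim ℂ W = s)
    (hdom : HasDominantAddProjection ℂ (W ∩ torusLocus ℂ s))
    (F : Fin s → Fin t → MvPolynomial (Fin (t + s)) ℂ) (h : MvPolynomial (Fin s) ℂ) (hh : h ≠ 0) :
    ∃ x : Fin s → ℂ, eval x h ≠ 0 ∧ (Sum.elim x (fun j => exp (x j) - ∑ k, exp (eval x (G k)) *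
        eval (Fin.append (fun k => exp (eval x (G k))) x) (F j k)) : Fin s ⊕ Fin s → ℂ) ∈ W := by
  classical
  obtain ⟨Q, hQ0, hdir⟩ := exists_localized_perturbed_of_dominant W hW hdim hdom
  set hT : MvPolynomial (Fin s) ℂ := homogeneousComponent h.totalDegree h with hhT
  have hQ'0 : Q * hT ≠ 0 := mul_ne_zero hQ0
    (Literature.NumberTheory.Transcendental.ExpDominant.homogeneousComponent_totalDegree_ne_zero hh)
  obtain ⟨q, hqQ', hq⟩ := exists_good_direction_forall (Q * hT) hQ'0
    (fun k => homogeneousComponent (G k).totalDegree (G k)) (fun k => (G k).totalDegree)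
    (fun k => homogeneousComponent_isHomogeneous _ _) q₀ hq₀
  set v : Fin s → ℂ := fun j => 2 * Real.pi * I * (q j : ℂ) with hv
  rw [map_mul] at hqQ'
  have hqQ : eval v Q ≠ 0 := left_ne_zero_of_mul hqQ'
  have hqh : eval v hT ≠ 0 := right_ne_zero_of_mul hqQ'
  have hεh : 0 < ‖eval v hT‖ / 2 := by positivity
  obtain ⟨ρh, hρh, th, hth, hnearh⟩ :=
    Literature.NumberTheory.Transcendental.ExpDominant.eval_smul_near_top h v hεh
  set c : Fin t → ℝ := fun k => -(eval v (homogeneousComponent (G k).totalDegree (G k))).re with hc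
  have hcpos : ∀ k, 0 < c k := fun k => by simp only [hc]; linarith [hq k]
  have hnear' := fun k =>
    Literature.NumberTheory.Transcendental.ExpDominant.eval_smul_near_top (G k) v (half_pos (hcpos k))
  choose ρg hρg tg htg hnear using hnear'
  set ρ₀ : ℝ := (∏ k, min 1 (ρg k)) * min 1 ρh with hρ₀
  have hP1 : ∏ k, min 1 (ρg k) ≤ 1 :=
    Finset.prod_le_one (fun k' _ => (lt_min one_pos (hρg k')).le) fun k' _ => min_le_left _ _
  have hP0 : 0 < ∏ k, min 1 (ρg k) := Finset.prod_pos fun k _ => lt_min one_pos (hρg k)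
  have hρ₀pos : 0 < ρ₀ := mul_pos hP0 (lt_min one_pos hρh)
  have hρ₀h : ρ₀ ≤ ρh :=
    calc ρ₀ ≤ 1 * min 1 ρh := mul_le_mul_of_nonneg_right hP1 (le_min zero_le_one hρh.le)
      _ ≤ ρh := by rw [one_mul]; exact min_le_right _ _
  have hρ₀le : ∀ k, ρ₀ ≤ ρg k := by
    intro k
    have h1 : ∏ k', min 1 (ρg k') ≤ ρg k := by
      rw [← Finset.mul_prod_erase Finset.univ (fun k' => min 1 (ρg k')) (Finset.mem_univ k)]
      calc min 1 (ρg k) * ∏ k' ∈ Finset.univ.erase k, min 1 (ρg k')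
          ≤ min 1 (ρg k) * 1 := by
            refine mul_le_mul_of_nonneg_left ?_ (le_min zero_le_one (hρg k).le)
            exact Finset.prod_le_one (fun k' _ => (lt_min one_pos (hρg k')).le)
              fun k' _ => min_le_left _ _
        _ ≤ ρg k := by rw [mul_one]; exact min_le_right _ _
    calc ρ₀ ≤ (∏ k', min 1 (ρg k')) * 1 :=
          mul_le_mul_of_nonneg_left (min_le_left _ _) hP0.le
      _ ≤ ρg k := by rw [mul_one]; exact h1
  obtain ⟨ρ, hρ, hρle, K, hK, Nn, m₁, hm⟩ := hdir q hqQ ρ₀ hρ₀pos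
  have hgrowth := fun j k =>
    Literature.NumberTheory.Transcendental.HypersurfaceCover.exists_norm_eval_le_pow (F j k)
  choose C hC N hCN using hgrowth
  set K' : ℝ := ‖v‖ + ρ with hK'
  have hK'0 : 0 ≤ K' := by positivity
  have hsmall : ∀ j k, ∀ᶠ m : ℕ in atTop,
      C j k * (2 + K') ^ N j k * (64 * (s + 1) * (Real.exp 1 * K)) * (t + 1) *
        ((m : ℝ) ^ (N j k + Nn) / Real.exp (c k / 2 * m)) ≤ 1 := by
    intro j k
    have h := (tendsto_pow_div_exp_natCast (N j k + Nn) (half_pos (hcpos k))).const_mul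
      (C j k * (2 + K') ^ N j k * (64 * (s + 1) * (Real.exp 1 * K)) * (t + 1))
    rw [mul_zero] at h
    exact h.eventually_le_const zero_lt_one
  have hall : ∀ᶠ m : ℕ in atTop, ((m₁ ≤ m ∧ th ≤ (m : ℝ)) ∧ ∀ k, tg k ≤ (m : ℝ)) ∧ ∀ j k,
      C j k * (2 + K') ^ N j k * (64 * (s + 1) * (Real.exp 1 * K)) * (t + 1) *
        ((m : ℝ) ^ (N j k + Nn) / Real.exp (c k / 2 * m)) ≤ 1 := by
    refine (((eventually_ge_atTop m₁).and
      (tendsto_natCast_atTop_atTop.eventually_ge_atTop th)).and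
        (eventually_all.2 fun k => ?_)).and
      (eventually_all.2 fun j => eventually_all.2 fun k => hsmall j k)
    exact tendsto_natCast_atTop_atTop.eventually_ge_atTop (tg k)
  obtain ⟨m, ⟨⟨hmm₁, hmth⟩, hmt⟩, hj⟩ := hall.exists
  obtain ⟨hm1, hmain⟩ := hm m hmm₁
  have hm1r : (1 : ℝ) ≤ m := by exact_mod_cast hm1
  have hm0 : (0 : ℝ) < m := by linarith
  have hmC : (m : ℂ) ≠ 0 := by exact_mod_cast hm0.ne'
  -- the perturbation
  set E : (Fin s → ℂ) → Fin t → ℂ := fun z k => exp (eval z (G k)) with hE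
  set Gp : Fin s → (Fin s → ℂ) → ℂ := fun j z =>
    ∑ k, E z k * eval (Fin.append (E z) z) (F j k) with hGp
  have hEdiff : ∀ k, Differentiable ℂ fun z => E z k := fun k =>
    (differentiable_mvPolynomial_eval (G k)).cexp
  have hGdiff : ∀ j, Differentiable ℂ (Gp j) := by
    intro j
    refine Differentiable.fun_sum fun k _ => ?_
    exact (hEdiff k).mul ((differentiable_mvPolynomial_eval (F j k)).comp (differentiable_finAppend hEdiff))
  have hGb : ∀ j, ∀ z ∈ ball ((m : ℂ) • v) (ρ * m),
      ‖Gp j z‖ ≤ (64 * (s + 1) * (Real.exp 1 * K * (m : ℝ) ^ Nn))⁻¹ := by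
    intro j z hz
    rw [mem_ball, dist_eq_norm] at hz
    set ζ : Fin s → ℂ := (m : ℂ)⁻¹ • (z - (m : ℂ) • v) with hζ
    have hzζ : z = ((m : ℝ) : ℂ) • (v + ζ) := by
      rw [Complex.ofReal_natCast, hζ, smul_add, smul_smul, mul_inv_cancel₀ hmC, one_smul,
        add_sub_cancel]
    have hζρ : ∀ k, ‖ζ‖ ≤ ρg k := fun k => by
      rw [hζ, norm_smul, norm_inv, Complex.norm_natCast, inv_mul_le_iff₀ hm0, mul_comm]
      exact hz.le.trans (mul_le_mul_of_nonneg_right (hρle.trans (hρ₀le k)) hm0.le)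
    have hEle : ∀ k, ‖E z k‖ ≤ (Real.exp (c k / 2 * m))⁻¹ := by
      intro k
      have hg' := hnear k m (hmt k) ζ (hζρ k)
      rw [← hzζ, Complex.ofReal_natCast] at hg'
      have hre : (eval z (G k)).re ≤ -(c k / 2 * m) := by
        have h1 : (eval z (G k) - (m : ℂ) ^ (G k).totalDegree *
            eval v (homogeneousComponent (G k).totalDegree (G k))).re ≤
            c k / 2 * (m : ℝ) ^ (G k).totalDegree := (Complex.re_le_norm _).trans hg'
        have h2 : ((m : ℂ) ^ (G k).totalDegree *
            eval v (homogeneousComponent (G k).totalDegree (G k))).re =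
            -(c k * (m : ℝ) ^ (G k).totalDegree) := by
          have : (m : ℂ) ^ (G k).totalDegree = (((m : ℝ) ^ (G k).totalDegree : ℝ) : ℂ) := by
            push_cast; rfl
          rw [this, Complex.re_ofReal_mul, hc]; ring
        rw [Complex.sub_re, h2] at h1
        have h3 : (m : ℝ) ≤ (m : ℝ) ^ (G k).totalDegree := le_self_pow₀ hm1r (hD k).ne'
        have := hcpos k
        nlinarith
      show ‖exp (eval z (G k))‖ ≤ _
      rw [Complex.norm_exp, ← Real.exp_neg]
      exact Real.exp_le_exp.mpr hre
    have hEle1 : ∀ k, ‖E z k‖ ≤ 1 := fun k =>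
      (hEle k).trans (inv_le_one_of_one_le₀ (Real.one_le_exp (by have := hcpos k; positivity)))
    have hzn : ‖z‖ ≤ K' * m := by
      calc ‖z‖ = ‖(m : ℂ) • v + (z - (m : ℂ) • v)‖ := by rw [add_sub_cancel]
        _ ≤ ‖(m : ℂ) • v‖ + ‖z - (m : ℂ) • v‖ := norm_add_le _ _
        _ ≤ m * ‖v‖ + ρ * m := by
            rw [norm_smul, Complex.norm_natCast]; exact add_le_add le_rfl hz.le
        _ = K' * m := by rw [hK']; ring
    have happ : ‖(Fin.append (E z) z : Fin (t + s) → ℂ)‖ ≤ 1 + K' * m :=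
      norm_finAppend_le hEle1 (by positivity) hzn
    have hpos : (0 : ℝ) < 64 * (s + 1) * (Real.exp 1 * K * (m : ℝ) ^ Nn) := by positivity
    have hterm : ∀ k, ‖E z k * eval (Fin.append (E z) z) (F j k)‖ *
        (64 * (s + 1) * (Real.exp 1 * K * (m : ℝ) ^ Nn)) * (t + 1) ≤ 1 := by
      intro k
      have hFb : ‖eval (Fin.append (E z) z) (F j k)‖ ≤ C j k * ((2 + K') * m) ^ N j k := by
        refine (hCN j k _).trans (mul_le_mul_of_nonneg_left ?_ (hC j k))
        refine pow_le_pow_left₀ (by positivity) ?_ _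
        nlinarith
      have h1 : ‖E z k * eval (Fin.append (E z) z) (F j k)‖ ≤
          (Real.exp (c k / 2 * m))⁻¹ * (C j k * ((2 + K') * m) ^ N j k) := by
        rw [norm_mul]; exact mul_le_mul (hEle k) hFb (norm_nonneg _) (by positivity)
      calc ‖E z k * eval (Fin.append (E z) z) (F j k)‖ *
            (64 * (s + 1) * (Real.exp 1 * K * (m : ℝ) ^ Nn)) * (t + 1)
          ≤ (Real.exp (c k / 2 * m))⁻¹ * (C j k * ((2 + K') * m) ^ N j k) *
            (64 * (s + 1) * (Real.exp 1 * K * (m : ℝ) ^ Nn)) * (t + 1) := by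
            gcongr
        _ = C j k * (2 + K') ^ N j k * (64 * (s + 1) * (Real.exp 1 * K)) * (t + 1) *
            ((m : ℝ) ^ (N j k + Nn) / Real.exp (c k / 2 * m)) := by
            rw [mul_pow, pow_add, div_eq_mul_inv]; ring
        _ ≤ 1 := hj j k
    rw [← one_div, le_div_iff₀ hpos]
    have ht1 : (0 : ℝ) < t + 1 := by positivity
    calc ‖Gp j z‖ * (64 * (s + 1) * (Real.exp 1 * K * (m : ℝ) ^ Nn))
        ≤ (∑ k, ‖E z k * eval (Fin.append (E z) z) (F j k)‖) *
            (64 * (s + 1) * (Real.exp 1 * K * (m : ℝ) ^ Nn)) :=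
          mul_le_mul_of_nonneg_right (norm_sum_le _ _) hpos.le
      _ = ∑ k, ‖E z k * eval (Fin.append (E z) z) (F j k)‖ *
            (64 * (s + 1) * (Real.exp 1 * K * (m : ℝ) ^ Nn)) := Finset.sum_mul _ _ _
      _ ≤ ∑ _k : Fin t, (1 : ℝ) / (t + 1) := Finset.sum_le_sum fun k _ => by
          rw [le_div_iff₀ ht1]; exact hterm k
      _ = t / (t + 1) := by
          rw [Finset.sum_const, Finset.card_univ, Fintype.card_fin, nsmul_eq_mul, mul_one_div]
      _ ≤ 1 := by rw [div_le_one ht1]; linarith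
  obtain ⟨x, hxball, hx⟩ := hmain Gp (fun j => (hGdiff j).differentiableOn) hGb
  refine ⟨x, ?_, hx⟩
  -- the solution avoids the hypersurface `h = 0`
  rw [mem_ball, dist_eq_norm] at hxball
  set ζ : Fin s → ℂ := (m : ℂ)⁻¹ • (x - (m : ℂ) • v) with hζ
  have hxζ : x = ((m : ℝ) : ℂ) • (v + ζ) := by
    rw [Complex.ofReal_natCast, hζ, smul_add, smul_smul, mul_inv_cancel₀ hmC, one_smul,
      add_sub_cancel]
  have hζρ : ‖ζ‖ ≤ ρh := by
    rw [hζ, norm_smul, norm_inv, Complex.norm_natCast, inv_mul_le_iff₀ hm0, mul_comm]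
    exact hxball.le.trans (mul_le_mul_of_nonneg_right (hρle.trans hρ₀h) hm0.le)
  have hnh := hnearh m hmth ζ hζρ
  rw [← hxζ, Complex.ofReal_natCast] at hnh
  intro hzero
  rw [hzero, zero_sub, norm_neg, norm_mul, norm_pow, Complex.norm_natCast] at hnh
  have hmd : (0 : ℝ) < (m : ℝ) ^ h.totalDegree := by positivity
  have : ‖eval v hT‖ ≤ ‖eval v hT‖ / 2 := le_of_mul_le_mul_left (by linarith [hnh]) hmd
  have hpos : 0 < ‖eval v hT‖ := norm_pos_iff.mpr hqh
  linarith

/-- **EC over a negative graph base of any codimension with Brownawell–Masser corner fibre**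
(plain form of `exists_expPoint_cornerBM_avoiding`, `h = 1`). [cite: MantovaMasser2023, §1 p.5 (the open range dim π(V) < n)] -/
theorem exists_expPoint_cornerBM {s t : ℕ} (G : Fin t → MvPolynomial (Fin s) ℂ)
    (hD : ∀ k, 0 < (G k).totalDegree) (q₀ : Fin s → ℤ)
    (hq₀ : ∀ k, (eval (fun j => 2 * Real.pi * I * (q₀ j : ℂ))
      (homogeneousComponent (G k).totalDegree (G k))).re < 0)
    (W : Set (Fin s ⊕ Fin s → ℂ)) (hW : IsIrreducibleClosed ℂ W) (hdim : zariskiDim ℂ W = s)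
    (hdom : HasDominantAddProjection ℂ (W ∩ torusLocus ℂ s))
    (F : Fin s → Fin t → MvPolynomial (Fin (t + s)) ℂ) :
    ∃ x : Fin s → ℂ, (Sum.elim x (fun j => exp (x j) - ∑ k, exp (eval x (G k)) *
        eval (Fin.append (fun k => exp (eval x (G k))) x) (F j k)) : Fin s ⊕ Fin s → ℂ) ∈ W := by
  obtain ⟨x, -, hx⟩ := exists_expPoint_cornerBM_avoiding G hD q₀ hq₀ W hW hdim hdom F 1 one_ne_zero
  exact ⟨x, hx⟩

/-- **The corner variety meets the graph of exponentiation** (EC-vocabulary form of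
`exists_expPoint_cornerBM`): with `n = t + s`, additive coordinates `(x'', x') ∈ ℂᵗ × ℂˢ` and
multiplicative coordinates `(u, y') ∈ ℂᵗ × ℂˢ` (blocks via `Fin.append`), the subvariety
`V = {x'' = G(x'), (x', (yⱼ - Σₖ uₖ Fⱼₖ(u, x'))ⱼ) ∈ W}` of `ℂⁿ × ℂⁿ` contains a point of
`Literature.NumberTheory.Transcendental.expGraph ℂ n`. [cite: MantovaMasser2023, §1 p.5 (the open range dim π(V) < n)] -/
theorem cornerBM_inter_expGraph_nonempty {s t : ℕ} (G : Fin t → MvPolynomial (Fin s) ℂ)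
    (hD : ∀ k, 0 < (G k).totalDegree) (q₀ : Fin s → ℤ)
    (hq₀ : ∀ k, (eval (fun j => 2 * Real.pi * I * (q₀ j : ℂ))
      (homogeneousComponent (G k).totalDegree (G k))).re < 0)
    (W : Set (Fin s ⊕ Fin s → ℂ)) (hW : IsIrreducibleClosed ℂ W) (hdim : zariskiDim ℂ W = s)
    (hdom : HasDominantAddProjection ℂ (W ∩ torusLocus ℂ s))
    (F : Fin s → Fin t → MvPolynomial (Fin (t + s)) ℂ) :
    ({z : Fin (t + s) ⊕ Fin (t + s) → ℂ |
        (∀ k : Fin t, z (Sum.inl (Fin.castAdd s k)) =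
          eval (fun j => z (Sum.inl (Fin.natAdd t j))) (G k)) ∧
        (Sum.elim (fun j => z (Sum.inl (Fin.natAdd t j)))
            (fun j => z (Sum.inr (Fin.natAdd t j)) - ∑ k, z (Sum.inr (Fin.castAdd s k)) *
              eval (Fin.append (fun k => z (Sum.inr (Fin.castAdd s k)))
                fun i => z (Sum.inl (Fin.natAdd t i))) (F j k)) : Fin s ⊕ Fin s → ℂ) ∈ W} ∩
      Literature.NumberTheory.Transcendental.expGraph ℂ (t + s)).Nonempty := by
  obtain ⟨x, hx⟩ := exists_expPoint_cornerBM G hD q₀ hq₀ W hW hdim hdom F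
  set X : Fin (t + s) → ℂ := Fin.append (fun k => eval x (G k)) x with hX
  refine ⟨Sum.elim X fun i => exp (X i), ⟨fun k => ?_, ?_⟩, fun i => ?_⟩
  · simp [hX, Fin.append_left, Fin.append_right]
  · simp only [Sum.elim_inl, Sum.elim_inr, hX, Fin.append_left, Fin.append_right]
    exact hx
  · simp [Literature.ModelTheory.ExponentialFields.ExponentialRing.complex_exp_eq]

end Summit.Schanuel.Schanuel.Theorems
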